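import Summits.CriticalPhenomena.PercolationContinuityZ3.Theorems.PercNearOneGluingNoHeavyLowerTailIncStarBranchLemmaStep
import Literature.Probability.Percolation.BergKahnLogSupermodular
import HarnessLib

/-!
# The two-target functional `Ψ` of the apex-forest calculus ((I2′)-tree), II: the two-branch bridge step

Support file for the Sahi programme (`--supports stmt-CriticalPhenomena-4575`, prover prim-sahi-p2 gen 19).  No definitions, no named
facts, no sorries; standard axioms.  Memo `FROM-prim-nh-lead-4575-g120-STAR-HALF.md` §8 (lead g120), `prim-sahi-p2/PROOF-E3.md` (29f).
`Ψ(w; v; b, c)` is the root-connection form of the lead's `Ψ_T` (see `…IncStarPsiSameBranch`).  Here: the case `b` and `c` in DIFFERENT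
branches at the port `v` — `b` (and `x₁`) in the near side `L ∌ s` of the environment bridge `e₁ = s(x₁, v)`, `c ∉ L` (anywhere else:
another branch at `v`, `v` itself, another tree).  Conditioning on `e₁` gives the identity (verified by `ring`)
  `Ψ(w; v; b, c) = A′·((1−p) + pA₁)·[ p·D₁b·(d_c + 2g_c − A′z_c) + d_c·((1−p)(2pH₁b + m_b(1 − pA₁)) + p²(D₁b + 2H₁b − A₁(m_b + D₁b))) ]`
with near quantities `A₁, D₁b, H₁b, m_b` of the instance `(w[e₁↦0]; x₁; b)` and far quantities `A′, d_c, g_c, z_c` of `(w[e₁↦0]; v; c)`,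
so `Ψ ≥ 0` follows from the BRANCH LEMMA (Br) at `(w[e₁↦0]; x₁, b)` and at `(w[e₁↦0]; v, c)` (`IncStar.branchLemma`; here hypotheses, so
that this file does not depend on the induction file) — the lead's `κ²A_BA_C[D_b(H_c+Cov_c) + D_c(H_b+Cov_b)] ≥ 0`.  No induction hypothesis on
`Ψ` is needed in this case.
-/

noncomputable section

namespace Summit.CriticalPhenomena.PercolationContinuityZ3.Theorems

namespace IncStar

open MeasureTheory Set Literature.Probability.Percolation Literature.Probability.LatticeModels EdgeInduction
open scoped Classical

variable {n : ℕ}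

/-- **The arithmetic of the two-branch step for `Ψ`.** [this work] -/
theorem psi_diffBranch_real (p A' A₁ Db Hb mb dc gc zc : ℝ) (hp0 : 0 ≤ p) (hp1 : p ≤ 1) (hA' : 0 ≤ A')
    (hA₁ : 0 ≤ A₁) (hA₁1 : A₁ ≤ 1) (hDb : 0 ≤ Db) (hHb : 0 ≤ Hb) (hmb : 0 ≤ mb) (hdc : 0 ≤ dc)
    (BrNear : A₁ * (mb + Db) ≤ Db + 2 * Hb) (BrFar : A' * zc ≤ dc + 2 * gc) :
    0 ≤ ((1 - p) * A' + p * (A₁ * A')) * (((1 - p) * 0 + p * (Db * gc)) + ((1 - p) * (mb * dc) + p * (Hb * dc))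
          + ((1 - p) * 0 + p * (Db * dc)))
      - ((1 - p) * 0 + p * (Db * A')) * ((1 - p) * dc + p * (A₁ * dc))
      + ((1 - p) * 0 + p * (Db * A'))
        * (((1 - p) * dc + p * (A₁ * dc)) + ((1 - p) * gc + p * (A₁ * gc))
          - ((1 - p) * A' + p * (A₁ * A')) * ((1 - p) * zc + p * zc))
      + ((1 - p) * dc + p * (A₁ * dc))
        * (((1 - p) * 0 + p * (Db * A')) + ((1 - p) * (mb * A') + p * (Hb * A'))
          - ((1 - p) * A' + p * (A₁ * A')) * ((1 - p) * mb + p * (mb + Db))) := by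
  have key : ((1 - p) * A' + p * (A₁ * A')) * (((1 - p) * 0 + p * (Db * gc)) + ((1 - p) * (mb * dc) + p * (Hb * dc))
          + ((1 - p) * 0 + p * (Db * dc)))
      - ((1 - p) * 0 + p * (Db * A')) * ((1 - p) * dc + p * (A₁ * dc))
      + ((1 - p) * 0 + p * (Db * A'))
        * (((1 - p) * dc + p * (A₁ * dc)) + ((1 - p) * gc + p * (A₁ * gc))
          - ((1 - p) * A' + p * (A₁ * A')) * ((1 - p) * zc + p * zc))
      + ((1 - p) * dc + p * (A₁ * dc))
        * (((1 - p) * 0 + p * (Db * A')) + ((1 - p) * (mb * A') + p * (Hb * A'))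
          - ((1 - p) * A' + p * (A₁ * A')) * ((1 - p) * mb + p * (mb + Db)))
      = A' * ((1 - p) + p * A₁) * (p * Db * (dc + 2 * gc - A' * zc)
          + dc * ((1 - p) * (2 * p * Hb + mb * (1 - p * A₁)) + p ^ 2 * (Db + 2 * Hb - A₁ * (mb + Db)))) := by ring
  rw [key]
  have hα : 0 ≤ (1 - p) + p * A₁ := by nlinarith
  have h1 : 0 ≤ p * Db * (dc + 2 * gc - A' * zc) := mul_nonneg (mul_nonneg hp0 hDb) (by linarith)
  have h2 : 0 ≤ 1 - p * A₁ := by nlinarith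
  have h3 : 0 ≤ (1 - p) * (2 * p * Hb + mb * (1 - p * A₁)) := mul_nonneg (by linarith) (add_nonneg (by positivity) (mul_nonneg hmb h2))
  have h4 : 0 ≤ p ^ 2 * (Db + 2 * Hb - A₁ * (mb + Db)) := mul_nonneg (by positivity) (by linarith)
  exact mul_nonneg (mul_nonneg hA' hα) (add_nonneg h1 (mul_nonneg hdc (add_nonneg h3 h4)))

/-- **`Ψ`, the two-branch bridge step** (the lead's case 'b, c in different sub-branches', root-connection form). [this work] -/
theorem psi_bridge_step_diffBranch (w : Sym2 (Fin n) → unitInterval) (L : Set (Fin n)) {s x₁ v b c : Fin n}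
    (hsL : s ∉ L) (hxL : x₁ ∈ L) (hvL : v ∉ L) (hbL : b ∈ L) (hcL : c ∉ L)
    (hcross : ∀ x y : Fin n, x ∈ L → y ∉ L → y ≠ s → s(x, y) ≠ s(x₁, v) → w s(x, y) = 0)
    (BrNear : (prodBernoulli (Function.update w s(x₁, v) 0)).real (openConn s x₁)ᶜ * (prodBernoulli (Function.update w s(x₁, v) 0)).real (openConn b x₁ ∪ openConn s b)
        ≤ (prodBernoulli (Function.update w s(x₁, v) 0)).real (openConn b x₁ \ openConn s x₁) + 2 * (prodBernoulli (Function.update w s(x₁, v) 0)).real ((openConn s x₁)ᶜ ∩ (openConn b x₁)ᶜ ∩ openConn s b))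
    (BrFar : (prodBernoulli (Function.update w s(x₁, v) 0)).real (openConn s v)ᶜ * (prodBernoulli (Function.update w s(x₁, v) 0)).real (openConn c v ∪ openConn s c)
        ≤ (prodBernoulli (Function.update w s(x₁, v) 0)).real (openConn c v \ openConn s v) + 2 * (prodBernoulli (Function.update w s(x₁, v) 0)).real ((openConn s v)ᶜ ∩ (openConn c v)ᶜ ∩ openConn s c)) :
    0 ≤ (prodBernoulli w).real (openConn s v)ᶜ * ((prodBernoulli w).real ((openConn b v \ openConn s v) ∩ openConn s c)
            + (prodBernoulli w).real ((openConn c v \ openConn s v) ∩ openConn s b) + (prodBernoulli w).real ((openConn b v ∩ openConn c v) \ openConn s v))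
        - (prodBernoulli w).real (openConn b v \ openConn s v) * (prodBernoulli w).real (openConn c v \ openConn s v)
        + (prodBernoulli w).real (openConn b v \ openConn s v) * ((prodBernoulli w).real (openConn c v \ openConn s v) + (prodBernoulli w).real ((openConn s v)ᶜ ∩ (openConn c v)ᶜ ∩ openConn s c)
            - (prodBernoulli w).real (openConn s v)ᶜ * (prodBernoulli w).real (openConn c v ∪ openConn s c))
        + (prodBernoulli w).real (openConn c v \ openConn s v) * ((prodBernoulli w).real (openConn b v \ openConn s v) + (prodBernoulli w).real ((openConn s v)ᶜ ∩ (openConn b v)ᶜ ∩ openConn s b)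
            - (prodBernoulli w).real (openConn s v)ᶜ * (prodBernoulli w).real (openConn b v ∪ openConn s b)) := by
  -- names
  set e : Sym2 (Fin n) := s(x₁, v)
  set w0 := Function.update w e 0 with hw0
  set w1 := Function.update w e 1
  have hs1 : s ∈ insert s L := Set.mem_insert s L
  have hx1 : x₁ ∈ insert s L := Set.mem_insert_of_mem s hxL
  have hb1 : b ∈ insert s L := Set.mem_insert_of_mem s hbL
  -- near events and far events
  set S : Set (BondConfig (Fin n)) := openConnIn (insert s L) s x₁
  set Bn : Set (BondConfig (Fin n)) := openConnIn (insert s L) s b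
  set Fb : Set (BondConfig (Fin n)) := openConnIn (insert s L) b x₁
  set W' : Set (BondConfig (Fin n)) := openConnIn Lᶜ s v
  set Cf : Set (BondConfig (Fin n)) := openConnIn Lᶜ s c
  set Rc : Set (BondConfig (Fin n)) := openConnIn Lᶜ c v
  -- (0) the bridge hypothesis under `w0`, the almost-sure set, independence
  have hw0cross : ∀ x y : Fin n, x ∈ L → y ∉ L → y ≠ s → w0 s(x, y) = 0 := by
    intro x y hx hy hys
    by_cases hxy : s(x, y) = e
    · rw [hxy, hw0, Function.update_self]
    · rw [hw0, Function.update_of_ne hxy]; exact hcross x y hx hy hys hxy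
  set G : Set (BondConfig (Fin n)) := {ω | ∀ e', w0 e' = 0 → e' ∉ ω}
  have hG1 : (prodBernoulli w0).real G = 1 := real_sureClosed w0
  have hωG : ∀ ω ∈ G, ∀ x y : Fin n, x ∈ L → y ∉ L → y ≠ s → s(x, y) ∉ ω :=
    fun ω hω x y hx hy hys => hω _ (hw0cross x y hx hy hys)
  have hm : ∀ X : Set (BondConfig (Fin n)), MeasurableSet X := fun _ => MeasurableSet.of_discrete
  have hdiff : ∀ {A B : Set (BondConfig (Fin n))} {K' : Set (Sym2 (Fin n))},
      DeterminedBy A K' → DeterminedBy B K' → DeterminedBy (A \ B) K' := by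
    intro A B K' hA hB
    rw [determinedBy_iff] at hA hB ⊢
    intro ω ω' h
    rw [Set.mem_sdiff, Set.mem_sdiff, hA ω ω' h, hB ω ω' h]
  have hdn : ∀ x y : Fin n, DeterminedBy (openConnIn (insert s L) x y : Set (BondConfig (Fin n)))
      {z : Sym2 (Fin n) | ¬ z.IsDiag ∧ ∀ x ∈ z, x ∈ insert s L} := fun x y => IncStarCutVertex.determinedBy_openConnIn_offDiag _ x y
  have hdf : ∀ x y : Fin n, DeterminedBy (openConnIn Lᶜ x y : Set (BondConfig (Fin n)))
      {z : Sym2 (Fin n) | ¬ z.IsDiag ∧ ∀ x ∈ z, x ∈ Lᶜ} := fun x y => IncStarCutVertex.determinedBy_openConnIn_offDiag _ x y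
  have hdW'c : DeterminedBy (Set.univ \ W') {z : Sym2 (Fin n) | ¬ z.IsDiag ∧ ∀ x ∈ z, x ∈ Lᶜ} := hdiff (determinedBy_univ _) (hdf s v)
  have indep : ∀ {A B : Set (BondConfig (Fin n))}, DeterminedBy A {z : Sym2 (Fin n) | ¬ z.IsDiag ∧ ∀ x ∈ z, x ∈ insert s L} →
      DeterminedBy B {z : Sym2 (Fin n) | ¬ z.IsDiag ∧ ∀ x ∈ z, x ∈ Lᶜ} →
      (prodBernoulli w0).real (A ∩ B) = (prodBernoulli w0).real A * (prodBernoulli w0).real B :=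
    fun hA hB => indep_blocks w0 L s hA hB
  -- elementary relations
  have hBFS : ∀ ω, ω ∈ Bn → ω ∈ Fb → ω ∈ S := fun ω hB hF => PlanarDuality.openConnIn_trans hB hF
  have hCRW : ∀ ω, ω ∈ Cf → ω ∈ Rc → ω ∈ W' := fun ω hC hR => PlanarDuality.openConnIn_trans hC hR
  -- (1) dictionary on the sure set
  have c_sv : ∀ ω ∈ G, (ω ∈ openConn s v ↔ ω ∈ W') := fun ω hω => by
    rw [bridge_conn_lr L hsL (hωG ω hω) hs1 hvL]
    exact ⟨fun h => h.2, fun h => ⟨⟨hs1, hs1, SimpleGraph.Reachable.refl _⟩, h⟩⟩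
  have c_sb : ∀ ω ∈ G, (ω ∈ openConn s b ↔ ω ∈ Bn) := fun ω hω => bridge_conn_ll L hsL (hωG ω hω) hs1 hb1
  have c_sc : ∀ ω ∈ G, (ω ∈ openConn s c ↔ ω ∈ Cf) := fun ω hω => by
    rw [bridge_conn_lr L hsL (hωG ω hω) hs1 hcL]
    exact ⟨fun h => h.2, fun h => ⟨⟨hs1, hs1, SimpleGraph.Reachable.refl _⟩, h⟩⟩
  have c_bv : ∀ ω ∈ G, (ω ∈ openConn b v ↔ ω ∈ Bn ∧ ω ∈ W') := fun ω hω => by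
    rw [bridge_conn_lr L hsL (hωG ω hω) hb1 hvL]
    exact ⟨fun h => ⟨openConnIn_symm' h.1, h.2⟩, fun h => ⟨openConnIn_symm' h.1, h.2⟩⟩
  have c_cv : ∀ ω ∈ G, (ω ∈ openConn c v ↔ ω ∈ Rc) := fun ω hω => bridge_conn_rr L hsL (hωG ω hω) hcL hvL
  have c_bx : ∀ ω ∈ G, (ω ∈ openConn b x₁ ↔ ω ∈ Fb) := fun ω hω => bridge_conn_ll L hsL (hωG ω hω) hb1 hx1
  have c_cx : ∀ ω ∈ G, (ω ∈ openConn c x₁ ↔ ω ∈ Cf ∧ ω ∈ S) := fun ω hω => by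
    rw [bridge_conn_rl L hsL (hωG ω hω) hcL hx1]
    exact ⟨fun h => ⟨openConnIn_symm' h.1, h.2⟩, fun h => ⟨openConnIn_symm' h.1, h.2⟩⟩
  have c_sx : ∀ ω ∈ G, (ω ∈ openConn s x₁ ↔ ω ∈ S) := fun ω hω => bridge_conn_ll L hsL (hωG ω hω) hs1 hx1
  -- (2) lifted events
  have l_sv : ∀ ω ∈ G, (insert e ω ∈ openConn s v ↔ ω ∈ W' ∨ ω ∈ S) := fun ω hω => by
    rw [bridge_lift_far L hsL hxL hvL hvL (hωG ω hω)]
    have hvv : ω ∈ openConnIn Lᶜ v v := ⟨hvL, hvL, SimpleGraph.Reachable.refl _⟩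
    exact ⟨fun h => h.imp id fun h' => h'.1, fun h => h.imp id fun h' => ⟨h', hvv⟩⟩
  have l_sb : ∀ ω ∈ G, (insert e ω ∈ openConn s b ↔ ω ∈ Bn ∨ (ω ∈ W' ∧ ω ∈ Fb)) := fun ω hω => by
    rw [bridge_lift_near L hsL hxL hvL hbL (hωG ω hω)]
    exact ⟨fun h => h.imp id fun h' => ⟨h'.1, openConnIn_symm' h'.2⟩, fun h => h.imp id fun h' => ⟨h'.1, openConnIn_symm' h'.2⟩⟩
  have l_sc : ∀ ω ∈ G, (insert e ω ∈ openConn s c ↔ ω ∈ Cf ∨ (ω ∈ S ∧ ω ∈ Rc)) := fun ω hω => by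
    rw [bridge_lift_far L hsL hxL hvL hcL (hωG ω hω)]
    exact ⟨fun h => h.imp id fun h' => ⟨h'.1, openConnIn_symm' h'.2⟩, fun h => h.imp id fun h' => ⟨h'.1, openConnIn_symm' h'.2⟩⟩
  have l_bv : ∀ ω ∈ G, (insert e ω ∈ openConn b v ↔ (ω ∈ Bn ∧ ω ∈ W') ∨ ω ∈ Fb) := fun ω hω => by
    rw [insert_pair_mem_openConn_iff, c_bv ω hω, c_bx ω hω]
    have hvv : ω ∈ openConn v v := SimpleGraph.Reachable.refl _
    constructor
    · rintro (h | ⟨h1, -⟩)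
      · exact Or.inl h
      · exact h1.symm
    · rintro (h | h)
      · exact Or.inl h
      · exact Or.inr ⟨Or.inl h, Or.inr hvv⟩
  have l_cv : ∀ ω ∈ G, (insert e ω ∈ openConn c v ↔ ω ∈ Rc ∨ (ω ∈ Cf ∧ ω ∈ S)) := fun ω hω => by
    rw [insert_pair_mem_openConn_iff, c_cv ω hω, c_cx ω hω]
    have hvv : ω ∈ openConn v v := SimpleGraph.Reachable.refl _
    constructor
    · rintro (h | ⟨h1, -⟩)
      · exact Or.inl h
      · exact h1.symm
    · rintro (h | h)
      · exact Or.inl h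
      · exact Or.inr ⟨Or.inl h, Or.inr hvv⟩
  -- (3) one-bond decomposition and the lift
  have ob : ∀ A : Set (BondConfig (Fin n)),
      (prodBernoulli w).real A = (1 - (w e : ℝ)) * (prodBernoulli w0).real A + (w e : ℝ) * (prodBernoulli w1).real A := by
    intro A
    have hA : DeterminedBy A (↑(Finset.univ : Finset (Sym2 (Fin n))) : Set (Sym2 (Fin n))) := by
      rw [determinedBy_iff]
      intro ω ω' h
      rw [Finset.coe_univ, Set.inter_univ, Set.inter_univ] at h
      rw [h]
    exact prodBernoulli_real_oneBond hA w (Finset.mem_univ e)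
  have lift : ∀ A : Set (BondConfig (Fin n)),
      (prodBernoulli w1).real A = (prodBernoulli w0).real ((fun ω : BondConfig (Fin n) => insert e ω) ⁻¹' A) :=
    fun A => tieLiftOne_real_one_eq w e A
  have zero_of_empty : ∀ {A : Set (BondConfig (Fin n))}, (∀ ω ∈ G, ω ∉ A) → (prodBernoulli w0).real A = 0 := by
    intro A hA
    have h : (prodBernoulli w0).real A = (prodBernoulli w0).real (∅ : Set (BondConfig (Fin n))) :=
      real_congr_of_sure hG1 fun ω hω => ⟨fun h => (hA ω hω h).elim, fun h => (Set.notMem_empty _ h).elim⟩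
    rw [h, measureReal_empty]
  -- (4) moments under `w0`
  have a0 : (prodBernoulli w0).real (openConn s v)ᶜ = (prodBernoulli w0).real (Set.univ \ W') :=
    real_congr_of_sure hG1 fun ω hω => by
      rw [Set.mem_compl_iff, c_sv ω hω, Set.mem_sdiff]; exact ⟨fun h => ⟨Set.mem_univ _, h⟩, fun h => h.2⟩
  have db0 : (prodBernoulli w0).real (openConn b v \ openConn s v) = 0 :=
    zero_of_empty fun ω hω h => by rw [Set.mem_sdiff, c_bv ω hω, c_sv ω hω] at h; exact h.2 h.1.2
  have dc0 : (prodBernoulli w0).real (openConn c v \ openConn s v) = (prodBernoulli w0).real (Rc \ W') :=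
    real_congr_of_sure hG1 fun ω hω => by rw [Set.mem_sdiff, Set.mem_sdiff, c_cv ω hω, c_sv ω hω]
  have dbc0 : (prodBernoulli w0).real ((openConn b v ∩ openConn c v) \ openConn s v) = 0 :=
    zero_of_empty fun ω hω h => by
      rw [Set.mem_sdiff, Set.mem_inter_iff, c_bv ω hω, c_sv ω hω] at h; exact h.2 h.1.1.2
  have xb0 : (prodBernoulli w0).real ((openConn b v \ openConn s v) ∩ openConn s c) = 0 :=
    zero_of_empty fun ω hω h => by
      rw [Set.mem_inter_iff, Set.mem_sdiff, c_bv ω hω, c_sv ω hω] at h; exact h.1.2 h.1.1.2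
  have xc0 : (prodBernoulli w0).real ((openConn c v \ openConn s v) ∩ openConn s b)
      = (prodBernoulli w0).real Bn * (prodBernoulli w0).real (Rc \ W') := by
    rw [← indep (hdn s b) (hdiff (hdf c v) (hdf s v))]
    refine real_congr_of_sure hG1 fun ω hω => ?_
    simp only [Set.mem_inter_iff, Set.mem_sdiff, c_cv ω hω, c_sv ω hω, c_sb ω hω]
    tauto
  have hb0 : (prodBernoulli w0).real ((openConn s v)ᶜ ∩ (openConn b v)ᶜ ∩ openConn s b)
      = (prodBernoulli w0).real Bn * (prodBernoulli w0).real (Set.univ \ W') := by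
    rw [← indep (hdn s b) hdW'c]
    refine real_congr_of_sure hG1 fun ω hω => ?_
    simp only [Set.mem_inter_iff, Set.mem_compl_iff, Set.mem_sdiff, Set.mem_univ, true_and, c_sv ω hω, c_bv ω hω, c_sb ω hω]
    tauto
  have hc0 : (prodBernoulli w0).real ((openConn s v)ᶜ ∩ (openConn c v)ᶜ ∩ openConn s c) = (prodBernoulli w0).real (Cf \ W') :=
    real_congr_of_sure hG1 fun ω hω => by
      simp only [Set.mem_inter_iff, Set.mem_compl_iff, Set.mem_sdiff, c_sv ω hω, c_cv ω hω, c_sc ω hω]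
      exact ⟨fun h => ⟨h.2, h.1.1⟩, fun h => ⟨⟨h.2, fun hR => h.2 (hCRW ω h.1 hR)⟩, h.1⟩⟩
  have zb0 : (prodBernoulli w0).real (openConn b v ∪ openConn s b) = (prodBernoulli w0).real Bn :=
    real_congr_of_sure hG1 fun ω hω => by
      rw [Set.mem_union, c_bv ω hω, c_sb ω hω]; exact ⟨fun h => h.elim (fun h' => h'.1) id, fun h => Or.inr h⟩
  have zc0 : (prodBernoulli w0).real (openConn c v ∪ openConn s c) = (prodBernoulli w0).real (Rc ∪ Cf) :=
    real_congr_of_sure hG1 fun ω hω => by rw [Set.mem_union, Set.mem_union, c_cv ω hω, c_sc ω hω]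
  -- (5) moments under `w1`
  have a1 : (prodBernoulli w1).real (openConn s v)ᶜ
      = (prodBernoulli w0).real (Set.univ \ S) * (prodBernoulli w0).real (Set.univ \ W') := by
    rw [lift, ← indep (hdiff (determinedBy_univ _) (hdn s x₁)) hdW'c]
    refine real_congr_of_sure hG1 fun ω hω => ?_
    simp only [Set.preimage_compl, Set.mem_compl_iff, Set.mem_preimage, l_sv ω hω, Set.mem_inter_iff, Set.mem_sdiff,
      Set.mem_univ, true_and]
    tauto
  have db1 : (prodBernoulli w1).real (openConn b v \ openConn s v)
      = (prodBernoulli w0).real (Fb \ S) * (prodBernoulli w0).real (Set.univ \ W') := by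
    rw [lift, ← indep (hdiff (hdn b x₁) (hdn s x₁)) hdW'c]
    refine real_congr_of_sure hG1 fun ω hω => ?_
    simp only [Set.preimage_sdiff, Set.mem_sdiff, Set.mem_preimage, l_bv ω hω, l_sv ω hω, Set.mem_inter_iff, Set.mem_univ,
      true_and]
    tauto
  have dc1 : (prodBernoulli w1).real (openConn c v \ openConn s v)
      = (prodBernoulli w0).real (Set.univ \ S) * (prodBernoulli w0).real (Rc \ W') := by
    rw [lift, ← indep (hdiff (determinedBy_univ _) (hdn s x₁)) (hdiff (hdf c v) (hdf s v))]
    refine real_congr_of_sure hG1 fun ω hω => ?_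
    simp only [Set.preimage_sdiff, Set.mem_sdiff, Set.mem_preimage, l_cv ω hω, l_sv ω hω, Set.mem_inter_iff, Set.mem_univ,
      true_and]
    tauto
  have dbc1 : (prodBernoulli w1).real ((openConn b v ∩ openConn c v) \ openConn s v)
      = (prodBernoulli w0).real (Fb \ S) * (prodBernoulli w0).real (Rc \ W') := by
    rw [lift, ← indep (hdiff (hdn b x₁) (hdn s x₁)) (hdiff (hdf c v) (hdf s v))]
    refine real_congr_of_sure hG1 fun ω hω => ?_
    simp only [Set.preimage_sdiff, Set.preimage_inter, Set.mem_sdiff, Set.mem_inter_iff, Set.mem_preimage, l_bv ω hω, l_cv ω hω,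
      l_sv ω hω]
    tauto
  have xb1 : (prodBernoulli w1).real ((openConn b v \ openConn s v) ∩ openConn s c)
      = (prodBernoulli w0).real (Fb \ S) * (prodBernoulli w0).real (Cf \ W') := by
    rw [lift, ← indep (hdiff (hdn b x₁) (hdn s x₁)) (hdiff (hdf s c) (hdf s v))]
    refine real_congr_of_sure hG1 fun ω hω => ?_
    simp only [Set.preimage_sdiff, Set.preimage_inter, Set.mem_sdiff, Set.mem_inter_iff, Set.mem_preimage, l_bv ω hω, l_sc ω hω,
      l_sv ω hω, not_or]
    constructor
    · rintro ⟨⟨hbv, hW, hS⟩, hc⟩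
      have hF : ω ∈ Fb := hbv.resolve_left fun h => hW h.2
      exact ⟨⟨hF, hS⟩, hc.resolve_right fun h => hS h.1, hW⟩
    · rintro ⟨⟨hF, hS⟩, hC, hW⟩
      exact ⟨⟨Or.inr hF, hW, hS⟩, Or.inl hC⟩
  have xc1 : (prodBernoulli w1).real ((openConn c v \ openConn s v) ∩ openConn s b)
      = (prodBernoulli w0).real ((Bn \ S) \ Fb) * (prodBernoulli w0).real (Rc \ W') := by
    rw [lift, ← indep (hdiff (hdiff (hdn s b) (hdn s x₁)) (hdn b x₁)) (hdiff (hdf c v) (hdf s v))]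
    refine real_congr_of_sure hG1 fun ω hω => ?_
    simp only [Set.preimage_sdiff, Set.preimage_inter, Set.mem_sdiff, Set.mem_inter_iff, Set.mem_preimage, l_cv ω hω, l_sb ω hω,
      l_sv ω hω, not_or]
    constructor
    · rintro ⟨⟨hcv, hW, hS⟩, hb⟩
      have hR : ω ∈ Rc := hcv.resolve_right fun h => hS h.2
      have hB : ω ∈ Bn := hb.resolve_right fun h => hW h.1
      exact ⟨⟨⟨hB, hS⟩, fun hF => hS (hBFS ω hB hF)⟩, hR, hW⟩
    · rintro ⟨⟨⟨hB, hS⟩, -⟩, hR, hW⟩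
      exact ⟨⟨Or.inl hR, hW, hS⟩, Or.inl hB⟩
  have hb1' : (prodBernoulli w1).real ((openConn s v)ᶜ ∩ (openConn b v)ᶜ ∩ openConn s b)
      = (prodBernoulli w0).real ((Bn \ S) \ Fb) * (prodBernoulli w0).real (Set.univ \ W') := by
    rw [lift, ← indep (hdiff (hdiff (hdn s b) (hdn s x₁)) (hdn b x₁)) hdW'c]
    refine real_congr_of_sure hG1 fun ω hω => ?_
    simp only [Set.preimage_inter, Set.preimage_compl, Set.mem_inter_iff, Set.mem_compl_iff, Set.mem_preimage,
      l_sv ω hω, l_bv ω hω, l_sb ω hω, Set.mem_sdiff, Set.mem_univ, true_and]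
    tauto
  have hc1' : (prodBernoulli w1).real ((openConn s v)ᶜ ∩ (openConn c v)ᶜ ∩ openConn s c)
      = (prodBernoulli w0).real (Set.univ \ S) * (prodBernoulli w0).real (Cf \ W') := by
    rw [lift, ← indep (hdiff (determinedBy_univ _) (hdn s x₁)) (hdiff (hdf s c) (hdf s v))]
    refine real_congr_of_sure hG1 fun ω hω => ?_
    simp only [Set.preimage_inter, Set.preimage_compl, Set.mem_inter_iff, Set.mem_compl_iff, Set.mem_preimage,
      l_sv ω hω, l_cv ω hω, l_sc ω hω, Set.mem_sdiff, Set.mem_univ, true_and]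
    constructor
    · rintro ⟨⟨hsv, hcv⟩, hsc⟩
      have hW : ω ∉ W' := fun h => hsv (Or.inl h)
      have hS : ω ∉ S := fun h => hsv (Or.inr h)
      exact ⟨hS, hsc.resolve_right fun h => hS h.1, hW⟩
    · rintro ⟨hS, hC, hW⟩
      refine ⟨⟨fun h => h.elim hW hS, fun h => h.elim (fun hR => hW (hCRW ω hC hR)) fun h' => hS h'.2⟩, Or.inl hC⟩
  have zb1 : (prodBernoulli w1).real (openConn b v ∪ openConn s b) = (prodBernoulli w0).real (Fb ∪ Bn) := by
    rw [lift]
    refine real_congr_of_sure hG1 fun ω hω => ?_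
    simp only [Set.preimage_union, Set.mem_union, Set.mem_preimage, l_bv ω hω, l_sb ω hω]
    tauto
  have zc1 : (prodBernoulli w1).real (openConn c v ∪ openConn s c) = (prodBernoulli w0).real (Rc ∪ Cf) := by
    rw [lift]
    refine real_congr_of_sure hG1 fun ω hω => ?_
    simp only [Set.preimage_union, Set.mem_union, Set.mem_preimage, l_cv ω hω, l_sc ω hω]
    tauto
  -- `Z₁b = m_b + D₁b`
  have zsb : (prodBernoulli w0).real (Fb ∪ Bn) = (prodBernoulli w0).real Bn + (prodBernoulli w0).real (Fb \ S) := by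
    rw [← measureReal_union ?_ (hm _)]
    · congr 1
      ext ω
      simp only [Set.mem_union, Set.mem_sdiff]
      constructor
      · rintro (hF | hT)
        · by_cases hT : ω ∈ Bn
          · exact Or.inl hT
          · exact Or.inr ⟨hF, fun hS => hT (PlanarDuality.openConnIn_trans hS (openConnIn_symm' hF))⟩
        · exact Or.inl hT
      · rintro (hT | ⟨hF, -⟩)
        · exact Or.inr hT
        · exact Or.inl hF
    · exact Set.disjoint_left.2 fun ω hT hFS => hFS.2 (hBFS ω hT hFS.1)
  -- the two branch lemmas in block form
  have eA₁ : (prodBernoulli w0).real (openConn s x₁)ᶜ = (prodBernoulli w0).real (Set.univ \ S) :=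
    real_congr_of_sure hG1 fun ω hω => by
      rw [Set.mem_compl_iff, c_sx ω hω, Set.mem_sdiff]; exact ⟨fun h => ⟨Set.mem_univ _, h⟩, fun h => h.2⟩
  have eDb : (prodBernoulli w0).real (openConn b x₁ \ openConn s x₁) = (prodBernoulli w0).real (Fb \ S) :=
    real_congr_of_sure hG1 fun ω hω => by rw [Set.mem_sdiff, Set.mem_sdiff, c_bx ω hω, c_sx ω hω]
  have eHb : (prodBernoulli w0).real ((openConn s x₁)ᶜ ∩ (openConn b x₁)ᶜ ∩ openConn s b)
      = (prodBernoulli w0).real ((Bn \ S) \ Fb) :=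
    real_congr_of_sure hG1 fun ω hω => by
      simp only [Set.mem_inter_iff, Set.mem_compl_iff, c_sx ω hω, c_bx ω hω, c_sb ω hω, Set.mem_sdiff]; tauto
  have eZb : (prodBernoulli w0).real (openConn b x₁ ∪ openConn s b) = (prodBernoulli w0).real (Fb ∪ Bn) :=
    real_congr_of_sure hG1 fun ω hω => by rw [Set.mem_union, Set.mem_union, c_bx ω hω, c_sb ω hω]
  have BrNear' := BrNear
  rw [eA₁, eZb, zsb, eDb, eHb] at BrNear'
  have BrFar' := BrFar
  rw [a0, zc0, dc0, hc0] at BrFar'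
  -- sign facts
  have hp0 : (0 : ℝ) ≤ w e := (w e).2.1
  have hp1 : (w e : ℝ) ≤ 1 := (w e).2.2
  have hA₁1 : (prodBernoulli w0).real (Set.univ \ S) ≤ 1 := measureReal_le_one
  -- (6) assemble
  rw [ob (openConn s v)ᶜ, ob (openConn b v \ openConn s v), ob (openConn c v \ openConn s v),
    ob ((openConn b v ∩ openConn c v) \ openConn s v), ob ((openConn b v \ openConn s v) ∩ openConn s c),
    ob ((openConn c v \ openConn s v) ∩ openConn s b), ob ((openConn s v)ᶜ ∩ (openConn b v)ᶜ ∩ openConn s b),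
    ob ((openConn s v)ᶜ ∩ (openConn c v)ᶜ ∩ openConn s c), ob (openConn b v ∪ openConn s b), ob (openConn c v ∪ openConn s c),
    a0, a1, db0, db1, dc0, dc1, dbc0, dbc1, xb0, xb1, xc0, xc1, hb0, hb1', hc0, hc1', zb0, zb1, zc0, zc1, zsb]
  have key := psi_diffBranch_real (w e) ((prodBernoulli w0).real (Set.univ \ W')) ((prodBernoulli w0).real (Set.univ \ S))
    ((prodBernoulli w0).real (Fb \ S)) ((prodBernoulli w0).real ((Bn \ S) \ Fb)) ((prodBernoulli w0).real Bn)
    ((prodBernoulli w0).real (Rc \ W')) ((prodBernoulli w0).real (Cf \ W')) ((prodBernoulli w0).real (Rc ∪ Cf))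
    hp0 hp1 measureReal_nonneg measureReal_nonneg hA₁1 measureReal_nonneg measureReal_nonneg measureReal_nonneg measureReal_nonneg
    BrNear' BrFar'
  linarith [key]

end IncStar

end Summit.CriticalPhenomena.PercolationContinuityZ3.Theorems
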